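import Literature.Computability.Complexity.CSPToCMMSAReduction
import Literature.Computability.Complexity.CodeFP
import HarnessLib

/-!
# Complexity core: the Dinur–Safra reduction from gap CSPs to CMMSA, V — the instance map as a typed `FP` program

Companion of `CSPToCMMSAReductionProofs.lean` on Hirahara's proof of Thm. 5.2 (ECCC TR22-119,
pp. 16–18). Files I–III (`CSPToCMMSA.lean`, `CSPToCMMSASoundness.lean`, `CSPToCMMSAReduction.lean`)
prove that the patched instance map `dinurSafraMap N₀ Q₀` is a Karp reduction of promise problems
from the gap CSP of the sliding-scale PCP to `gapCMMSA`, relative to the *implementation fact*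
`dinurSafraMap_mem_FP` ("the reduction is polynomial-time": some `f ∈ FP` maps the code of every
MaxCSP instance `Ψ` to the code of `dinurSafraMap N₀ Q₀ Ψ`); file IV
(`CSPToCMMSAReductionProofs.lean`) discharges it at the level of the string bricks
(`dinurSafraMap_mem_FP_holds`). This file is the **typed proof** of the same fact — the first client
of the algebra `CodeFP` of polynomial-time maps between encoded types (`CodeFP.lean`): the map is
written as a functional program on the tuples behind the two encodings and its polynomial-time
computability on Mathlib's `TM2` model is read off the program, combinator by combinator
(`codeFP_dinurSafraMap`; the fact `dinurSafraMap_mem_FP` is literally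
`fun N₀ Q₀ => codeFP_dinurSafraMap N₀ Q₀`), with a single size estimate discharged by hand.

* The map on tuples. `CSPInstance.encoding` / `CMMSAInstance.encoding` code an instance through its
  tuple `(n, q, [(varsⱼ, acceptingⱼ)]ⱼ)` / `(n, Φ, w, s)`; we write `dinurSafraMap` as an explicit
  functional program `dsT N₀ Q₀ : TI → TO` on tuples — the well-formedness test `wfB`, the brute-force
  satisfiability test `satB` over the constant list `tables Q₀ N₀` of value tables `[N₀] → {0, …, Q₀}`
  (`satB_toTuple`: correct on well-formed instances with `n ≤ N₀`, `|Σ| ≤ Q₀`, where accepted values are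
  `< |Σ|`), the size guard `fitsB` (`n, |Σ| ≤ Σⱼ |dom Cⱼ| = |varOcc|`), and the Dinur–Safra instance
  `outT` (literal width `lw = max |Σ| 1`, formulas by `zipWith`, the weights `|Ψ(x)|` by a counting scan
  `occF` inside two loops bounded by the budget list `varOcc`, `weightsT_eq`, threshold `|varOcc|`) —
  and prove `dsT N₀ Q₀ Ψ.toTuple = (dinurSafraMap N₀ Q₀ Ψ).toTuple` (`dsT_toTuple`).
* Polynomial time. `codeFP_dsT : CodeFP tiE toE (dsT N₀ Q₀)` is assembled from the combinators of
  `CodeFP.lean` along the structure of the program (`codeFP_cwfB`, `codeFP_wfB`, `codeFP_satB`,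
  `codeFP_fitsB`, `codeFP_termOf`, `codeFP_formulasT`, `codeFP_occF`, `codeFP_weightsT`, `codeFP_outT`),
  where `tiE`, `toE` are the tuple codes (`tiE_eq`, `toE_eq` identify them with the `encode` fields of
  the two `tupleEncoding`s). The only size estimate discharged here is the (linear) bound on the unary
  counter of `occF`; all others are internal to the combinators.
* `codeFP_dinurSafraMap` — `CodeFP CSPInstance.encoding.encode CMMSAInstance.encoding.encode
  (dinurSafraMap N₀ Q₀)` for all `N₀ Q₀`, i.e. the fact `dinurSafraMap_mem_FP` unfolded (a second
  proof of the fact discharged in `CSPToCMMSAReductionProofs.lean`; not restated under a new name).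

## References

* S. Hirahara, *NP-hardness of learning programs and partial MCSP*, FOCS 2022; ECCC TR22-119:
  Thm. 5.2 and its proof (p. 16: "it is NP-hard under polynomial-time many-one reductions … we reduce
  it to an instance `(Φ, w, s)` of CMMSA as follows").
* S. Arora, B. Barak, *Computational Complexity: A Modern Approach*, CUP 2009, §1.3 (robustness of
  polynomial time), §2.1 (Karp reductions; finitely many instances may be hard-wired).
-/

namespace Literature.Computability.Complexity

open _root_.Computability MetaComplexity CodeFP

namespace CSPToCMMSAMachine

/-! ### The map on tuples -/

/-- Constraint tuples `(vars, accepting)`. [folklore] -/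
abbrev Constr : Type := List ℕ × List (List ℕ)

/-- Input tuples `(n, q, [(varsⱼ, acceptingⱼ)]ⱼ)` (`CSPInstance.toTuple`). [folklore] -/
abbrev TI : Type := ℕ × ℕ × List Constr

/-- Output tuples `(n, Φ, w, s)` (`CMMSAInstance.toTuple`). [folklore] -/
abbrev TO : Type := ℕ × List (List (List ℕ)) × List ℕ × ℕ

/-- Well-formedness of one constraint, as a Boolean test. [cite: Hirahara2022PartialMCSP, proof of Thm. 5.2 (p. 16)] -/
def cwfB (n q : ℕ) (C : Constr) : Bool :=
  (C.1.all fun x => decide (x < n)) && decide C.1.Nodup && decide C.2.Nodup &&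
    C.2.all fun r => decide (r.length = C.1.length) && r.all fun v => decide (v < q)

/-- `cwfB` decides `CSPConstraint.WellFormed`. [cite: Hirahara2022PartialMCSP, proof of Thm. 5.2 (p. 16)] -/
theorem cwfB_eq (n q : ℕ) (C : CSPConstraint) :
    cwfB n q (C.vars, C.accepting) = decide (C.WellFormed n q) := by
  rw [Bool.eq_iff_iff, decide_eq_true_iff]
  simp [cwfB, CSPConstraint.WellFormed, List.all_eq_true, and_assoc]

/-- Well-formedness of an instance tuple. [cite: Hirahara2022PartialMCSP, proof of Thm. 5.2 (p. 16)] -/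
def wfB (t : TI) : Bool := !t.2.2.isEmpty && t.2.2.all (cwfB t.1 t.2.1)

/-- `wfB` decides `CSPInstance.WellFormed` on the tuple of an instance. [cite: Hirahara2022PartialMCSP, proof of Thm. 5.2 (p. 16)] -/
theorem wfB_toTuple (Ψ : CSPInstance) : wfB Ψ.toTuple = decide Ψ.WellFormed := by
  rw [Bool.eq_iff_iff, decide_eq_true_iff]
  simp only [wfB, CSPInstance.toTuple, CSPInstance.WellFormed, CSPInstance.numConstraints, Bool.and_eq_true,
    Bool.not_eq_true', List.all_map, List.all_eq_true, Function.comp_apply, cwfB_eq, decide_eq_true_eq,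
    List.isEmpty_eq_false_iff, List.length_pos_iff, ne_eq]
  rw [List.map_eq_nil_iff]

/-- All value tables `[N₀] → {0, …, Q₀}` as lists. [folklore] -/
def tables (Q₀ : ℕ) : ℕ → List (List ℕ)
  | 0 => [[]]
  | k + 1 => ((tables Q₀ k).map fun g => (List.range (Q₀ + 1)).map fun v => v :: g).flatten

/-- The tables of length `k` are exactly the lists of length `k` with entries `≤ Q₀`. [folklore] -/
theorem mem_tables {Q₀ : ℕ} : ∀ {k : ℕ} {g : List ℕ}, g ∈ tables Q₀ k ↔ g.length = k ∧ ∀ v ∈ g, v ≤ Q₀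
  | 0, g => by simp [tables, List.length_eq_zero_iff]; rintro rfl; simp
  | k + 1, g => by
    simp only [tables, List.mem_flatten, List.mem_map]
    constructor
    · rintro ⟨l, ⟨g', hg', rfl⟩, hg⟩
      obtain ⟨v, hv, rfl⟩ := List.mem_map.1 hg
      obtain ⟨hlen, hval⟩ := mem_tables.1 hg'
      refine ⟨by simp [hlen], ?_⟩
      simp only [List.mem_cons, forall_eq_or_imp]
      exact ⟨Nat.lt_succ_iff.1 (List.mem_range.1 hv), hval⟩
    · rintro ⟨hlen, hval⟩
      cases g with
      | nil => simp at hlen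
      | cons v g =>
        simp only [List.length_cons, Nat.add_right_cancel_iff] at hlen
        simp only [List.mem_cons, forall_eq_or_imp] at hval
        exact ⟨_, ⟨g, mem_tables.2 ⟨hlen, hval.2⟩, rfl⟩,
          List.mem_map.2 ⟨v, List.mem_range.2 (Nat.lt_succ_iff.2 hval.1), rfl⟩⟩

/-- The satisfiability test of one table. [cite: Hirahara2022PartialMCSP, proof of Thm. 5.2 (p. 17)] -/
def satTestB (cs : List Constr) (g : List ℕ) : Bool :=
  cs.all fun C => decide ((C.1.map fun x => g.getD x 0) ∈ C.2)

/-- Brute-force satisfiability on at most `N₀` variables over an alphabet of size at most `Q₀` (the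
finite patch of `dinurSafraMap`). [cite: AroraBarak2009, §2.1 (finitely many instances may be hard-wired into a Karp reduction)] -/
def satB (N₀ Q₀ : ℕ) (t : TI) : Bool := (tables Q₀ N₀).any (satTestB t.2.2)

/-- Reading a tabulated function. [folklore] -/
theorem getD_map_range {N x : ℕ} (h : ℕ → ℕ) (hx : x < N) : ((List.range N).map h).getD x 0 = h x := by
  rw [List.getD_eq_getElem?_getD, List.getElem?_map, List.getElem?_range hx]
  rfl

/-- **The brute force is correct**: on a well-formed instance with `n ≤ N₀` and `|Σ| ≤ Q₀`, `satB` decides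
satisfiability (a satisfying assignment may be clipped to values `≤ Q₀` on `[N₀]`, since accepted values
are `< |Σ|`). [cite: Hirahara2022PartialMCSP, proof of Thm. 5.2 (p. 17, completeness), with AroraBarak2009, §2.1 (finitely many instances hard-wired)] -/
theorem satB_toTuple {Ψ : CSPInstance} {N₀ Q₀ : ℕ} (hwf : Ψ.WellFormed) (hn : Ψ.numVars ≤ N₀)
    (hq : Ψ.alphabetSize ≤ Q₀) : satB N₀ Q₀ Ψ.toTuple = true ↔ Ψ.IsSatisfiable := by
  rw [satB, List.any_eq_true]
  simp only [CSPInstance.toTuple, satTestB, List.all_map, List.all_eq_true, Function.comp_apply,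
    decide_eq_true_eq]
  constructor
  · rintro ⟨g, -, hg⟩
    exact ⟨fun x => g.getD x 0, fun C hC => (C.isSatisfiedBy_eq_true_iff _).2 (hg C hC)⟩
  · rintro ⟨a, ha⟩
    refine ⟨(List.range N₀).map fun x => if a x ≤ Q₀ then a x else 0, mem_tables.2 ⟨by simp, ?_⟩, ?_⟩
    · intro v hv
      obtain ⟨x, -, rfl⟩ := List.mem_map.1 hv
      split_ifs with h
      · exact h
      · exact Nat.zero_le _
    · intro C hC
      have hsat := (C.isSatisfiedBy_eq_true_iff a).1 (ha C hC)
      have hCwf := hwf.2 C hC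
      suffices heq : (C.vars.map fun x => ((List.range N₀).map fun x => if a x ≤ Q₀ then a x else 0).getD x 0) =
          C.vars.map a by rw [heq]; exact hsat
      refine List.map_congr_left fun x hx => ?_
      rw [getD_map_range _ ((hCwf.1 x hx).trans_le hn), if_pos]
      have hv := (hCwf.2.2.2 _ hsat).2 (a x) (List.mem_map.2 ⟨x, hx, rfl⟩)
      exact (hv.le.trans hq)

/-- All variable occurrences `dom C₁ ++ ⋯ ++ dom C_m` (a list of length `Σⱼ |dom Cⱼ|`). [cite: Hirahara2022PartialMCSP, proof of Thm. 5.2 (p. 16, "s := mD")] -/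
def varOcc (cs : List Constr) : List ℕ := (cs.map Prod.fst).flatten

/-- `|varOcc| = Σⱼ |dom Cⱼ|`. [cite: Hirahara2022PartialMCSP, proof of Thm. 5.2 (p. 16, "s := mD")] -/
theorem length_varOcc (Ψ : CSPInstance) : (varOcc Ψ.toTuple.2.2).length = Ψ.totalArity := by
  simp [varOcc, CSPInstance.toTuple, CSPInstance.totalArity, List.length_flatten, Function.comp_def]

/-- The size guard `n, |Σ| ≤ Σⱼ |dom Cⱼ|` of `dinurSafraMap`. [folklore] -/
def fitsB (t : TI) : Bool :=
  decide (t.1 ≤ (varOcc t.2.2).length) && decide (t.2.1 ≤ (varOcc t.2.2).length)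

/-- The literal width `max |Σ| 1`. [cite: Hirahara2022PartialMCSP, proof of Thm. 5.2 (p. 16)] -/
def lw (q : ℕ) : ℕ := if decide (q < 1) then 1 else q

/-- `lw |Σ| = q₁`. [folklore] -/
theorem lw_eq (Ψ : CSPInstance) : lw Ψ.alphabetSize = Ψ.litWidth := by
  unfold lw CSPInstance.litWidth
  by_cases h : Ψ.alphabetSize < 1
  · rw [decide_eq_true h, if_pos rfl]; omega
  · rw [decide_eq_false h]; simp; omega

/-- The term `⋀_{x ∈ dom r} L_{x, r(x)}` of an accepting local assignment. [cite: Hirahara2022PartialMCSP, proof of Thm. 5.2 (p. 16)] -/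
def termOf (q₁ : ℕ) (vars r : List ℕ) : List ℕ := List.zipWith (fun x a => x * q₁ + a) vars r

/-- The formulas `φⱼ`. [cite: Hirahara2022PartialMCSP, proof of Thm. 5.2 (p. 16)] -/
def formulasT (q₁ : ℕ) (cs : List Constr) : List (List (List ℕ)) := cs.map fun C => C.2.map (termOf q₁ C.1)

/-- `formulasT` computes the formulas of `toCMMSA`. [cite: Hirahara2022PartialMCSP, proof of Thm. 5.2 (p. 16)] -/
theorem formulasT_eq (Ψ : CSPInstance) : formulasT Ψ.litWidth Ψ.toTuple.2.2 = Ψ.toCMMSA.formulas := by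
  simp only [formulasT, CSPInstance.toTuple, CSPInstance.toCMMSA, List.map_map]
  rfl

/-- `|Ψ(x)|` by a counting scan. [cite: Hirahara2022PartialMCSP, proof of Thm. 5.2 (p. 16)] -/
def occF (cs : List Constr) (x : ℕ) : ℕ := cs.foldl (fun k C => if decide (x ∈ C.1) then k + 1 else k) 0

/-- A counting scan counts. [folklore] -/
theorem foldl_count_eq (p : Constr → Bool) (cs : List Constr) (k : ℕ) :
    cs.foldl (fun k C => if p C then k + 1 else k) k = k + cs.countP p := by
  induction cs generalizing k with
  | nil => simp
  | cons C cs ih =>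
    rw [List.foldl_cons, ih, List.countP_cons]
    cases p C <;> simp
    omega

/-- `occF` computes `|Ψ(x)|`. [cite: Hirahara2022PartialMCSP, proof of Thm. 5.2 (p. 16)] -/
theorem occF_eq (Ψ : CSPInstance) (x : ℕ) : occF Ψ.toTuple.2.2 x = Ψ.occCount x := by
  rw [occF, foldl_count_eq, Nat.zero_add, CSPInstance.occCount, CSPInstance.toTuple]
  simp only [List.countP_map]
  rfl

/-- The weights `w(x · q₁ + a) = |Ψ(x)|`, generated by two bounded loops. [cite: Hirahara2022PartialMCSP, proof of Thm. 5.2 (p. 16)] -/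
def weightsT (n q₁ : ℕ) (cs : List Constr) : List ℕ :=
  (((List.range (min n (varOcc cs).length)).map fun x =>
    (List.range (min q₁ (0 :: varOcc cs).length)).map fun _ => occF cs x)).flatten

/-- Two nested loops of lengths `n` and `q` enumerate `[n · q]`, the outer index being `i / q`. [folklore] -/
theorem flatten_map_range (f : ℕ → ℕ) (q : ℕ) : ∀ n : ℕ,
    ((List.range n).map fun x => (List.range q).map fun _ => f x).flatten = (List.range (n * q)).map fun i => f (i / q)
  | 0 => by simp
  | n + 1 => by
    rw [List.range_succ, List.map_append, List.flatten_append, flatten_map_range f q n, Nat.succ_mul,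
      List.range_add, List.map_append, List.map_map]
    simp only [List.map_cons, List.map_nil, List.flatten_cons, List.flatten_nil, List.append_nil]
    congr 1
    refine List.map_congr_left fun j hj => ?_
    have hq : 0 < q := Nat.pos_of_ne_zero (by rintro rfl; simp at hj)
    simp only [Function.comp_apply]
    rw [Nat.add_comm, Nat.add_mul_div_right _ _ hq, Nat.div_eq_of_lt (List.mem_range.1 hj), Nat.zero_add]

/-- `weightsT` computes the weights of `toCMMSA` when `n, |Σ| ≤ Σⱼ |dom Cⱼ|`. [cite: Hirahara2022PartialMCSP, proof of Thm. 5.2 (p. 16)] -/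
theorem weightsT_eq (Ψ : CSPInstance) (hn : Ψ.numVars ≤ Ψ.totalArity) (hq : Ψ.alphabetSize ≤ Ψ.totalArity) :
    weightsT Ψ.numVars Ψ.litWidth Ψ.toTuple.2.2 = Ψ.toCMMSA.weight := by
  rw [weightsT, length_varOcc, List.length_cons, length_varOcc, min_eq_left hn,
    min_eq_left (show Ψ.litWidth ≤ Ψ.totalArity + 1 from max_le (by omega) (by omega)), flatten_map_range]
  simp only [occF_eq]
  rfl

/-- The Dinur–Safra instance on tuples. [cite: Hirahara2022PartialMCSP, proof of Thm. 5.2 (p. 16)] -/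
def outT (t : TI) : TO :=
  (t.1 * lw t.2.1, formulasT (lw t.2.1) t.2.2, weightsT t.1 (lw t.2.1) t.2.2, (varOcc t.2.2).length)

/-- **`outT` is `toCMMSA` on tuples** (under the size guard). [cite: Hirahara2022PartialMCSP, proof of Thm. 5.2 (p. 16)] -/
theorem outT_toTuple (Ψ : CSPInstance) (hn : Ψ.numVars ≤ Ψ.totalArity) (hq : Ψ.alphabetSize ≤ Ψ.totalArity) :
    outT Ψ.toTuple = Ψ.toCMMSA.toTuple := by
  have h1 : (Ψ.toTuple).1 = Ψ.numVars := rfl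
  have h2 : (Ψ.toTuple).2.1 = Ψ.alphabetSize := rfl
  rw [outT, h1, h2, lw_eq, formulasT_eq, weightsT_eq Ψ hn hq, length_varOcc]
  rfl

/-- The tuple of `trivialYesCMMSA`. [folklore] -/
def yesT : TO := (0, [], [], 0)

/-- The tuple of `trivialNoCMMSA`. [folklore] -/
def noT : TO := (2, [[]], [0, 0], 0)

/-- **`dinurSafraMap` on tuples.** [cite: Hirahara2022PartialMCSP, proof of Thm. 5.2 (p. 16), with the finite patch] -/
def dsT (N₀ Q₀ : ℕ) (t : TI) : TO :=
  if wfB t && (decide (t.1 ≤ N₀) && decide (t.2.1 ≤ Q₀)) then (if satB N₀ Q₀ t then yesT else noT)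
  else if fitsB t then outT t else noT

/-- **`dsT` is `dinurSafraMap` on tuples.** [cite: Hirahara2022PartialMCSP, proof of Thm. 5.2 (p. 16), with AroraBarak2009, §2.1] -/
theorem dsT_toTuple (N₀ Q₀ : ℕ) (Ψ : CSPInstance) :
    dsT N₀ Q₀ Ψ.toTuple = (dinurSafraMap N₀ Q₀ Ψ).toTuple := by
  have h1 : (Ψ.toTuple).1 = Ψ.numVars := rfl
  have h2 : (Ψ.toTuple).2.1 = Ψ.alphabetSize := rfl
  have hfits : fitsB Ψ.toTuple = decide (Ψ.numVars ≤ Ψ.totalArity ∧ Ψ.alphabetSize ≤ Ψ.totalArity) := by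
    rw [fitsB, length_varOcc, h1, h2, Bool.decide_and]
  unfold dsT dinurSafraMap
  rw [wfB_toTuple, h1, h2, hfits]
  by_cases hA : Ψ.WellFormed ∧ Ψ.numVars ≤ N₀ ∧ Ψ.alphabetSize ≤ Q₀
  · rw [if_pos hA, if_pos (by simp [hA])]
    by_cases hS : Ψ.IsSatisfiable
    · rw [if_pos hS, if_pos ((satB_toTuple hA.1 hA.2.1 hA.2.2).2 hS)]; rfl
    · rw [if_neg hS, if_neg (fun h => hS ((satB_toTuple hA.1 hA.2.1 hA.2.2).1 h))]; rfl
  · rw [if_neg hA, if_neg (by simpa [Bool.and_eq_true, decide_eq_true_eq, and_assoc] using hA)]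
    by_cases hB : Ψ.numVars ≤ Ψ.totalArity ∧ Ψ.alphabetSize ≤ Ψ.totalArity
    · rw [if_pos hB, decide_eq_true hB, if_pos rfl, outT_toTuple Ψ hB.1 hB.2]
    · rw [if_neg hB, decide_eq_false hB]; rfl

/-! ### Codes -/

/-- The code of a constraint tuple (as inside `CSPInstance.encoding`). [folklore] -/
def cE : Constr → List Bool := pairE (listE natE) (listE (listE natE))

/-- The code of input tuples (`CSPInstance.tupleEncoding`, `tiE_eq`). [folklore] -/
def tiE : TI → List Bool := pairE natE (pairE natE (listE cE))

/-- The code of output tuples (`CMMSAInstance.tupleEncoding`, `toE_eq`). [folklore] -/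
def toE : TO → List Bool := pairE natE (pairE (listE (listE (listE natE))) (pairE (listE unE) natE))

/-- `CSPInstance.tupleEncoding` codes by `tiE`. [folklore] -/
theorem tiE_eq : (CSPInstance.tupleEncoding.encode : TI → List Bool) = tiE := by
  simp only [CSPInstance.tupleEncoding, pairE_eq, listE_eq, natE_eq]; rfl

/-- `CMMSAInstance.tupleEncoding` codes by `toE`. [folklore] -/
theorem toE_eq : (CMMSAInstance.tupleEncoding.encode : TO → List Bool) = toE := by
  simp only [CMMSAInstance.tupleEncoding, pairE_eq, listE_eq, natE_eq, unE_eq]; rfl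

/-! ### The tests and the instance map are polynomial time on codes -/

section Typed

/-- `x < n` on `(n, x)`. [folklore] -/
theorem codeFP_ltSwap : CodeFP (pairE natE natE) bitE (fun p => decide (p.2 < p.1)) :=
  natLt.comp ((snd natE natE).pair (fst natE natE))

/-- Well-formedness of a constraint. [folklore] -/
theorem codeFP_cwfB : CodeFP (pairE (pairE natE natE) cE) bitE (fun p => cwfB p.1.1 p.1.2 p.2) := by
  let inE : (ℕ × ℕ) × Constr → List Bool := pairE (pairE natE natE) cE
  have hn : CodeFP inE natE (fun t => t.1.1) := (fst _ _).fst'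
  have hq : CodeFP inE natE (fun t => t.1.2) := (fst _ _).snd'
  have hvars : CodeFP inE (rawE natE) (fun t => t.2.1) := (rawOfList natE).comp (snd _ _).fst'
  have hacc : CodeFP inE (rawE (listE natE)) (fun t => t.2.2) := (rawOfList _).comp (snd _ _).snd'
  have p1 : CodeFP inE bitE (fun t => t.2.1.all fun x => decide (x < t.1.1)) :=
    (all codeFP_ltSwap).comp (hn.pair hvars)
  have p2 : CodeFP inE bitE (fun t => decide t.2.1.Nodup) := (nodup natE_injective).comp hvars
  have p3 : CodeFP inE bitE (fun t => decide t.2.2.Nodup) :=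
    (nodup (listE_injective natE_injective)).comp hacc
  -- the test on one accepting local assignment `r`, context `(q, |vars|)`
  let rcE : (ℕ × ℕ) × List ℕ → List Bool := pairE (pairE natE unE) (listE natE)
  have hr : CodeFP rcE (rawE natE) (fun u => u.2) := (rawOfList natE).comp (snd _ _)
  have r1 : CodeFP rcE bitE (fun u => decide (u.2.length = u.1.2)) :=
    (eq unE_injective).comp (((ulength natE).comp hr).pair (fst _ _).snd')
  have r2 : CodeFP rcE bitE (fun u => u.2.all fun v => decide (v < u.1.1)) :=
    (all codeFP_ltSwap).comp ((fst _ _).fst'.pair hr)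
  have p4 : CodeFP inE bitE
      (fun t => t.2.2.all fun r => decide (r.length = t.2.1.length) && r.all fun v => decide (v < t.1.2)) :=
    (all (r1.and r2)).comp ((hq.pair ((ulength natE).comp hvars)).pair hacc)
  exact (((p1.and p2).and p3).and p4).congr fun _ => rfl

/-- The list of constraints, raw. [folklore] -/
theorem codeFP_cs : CodeFP tiE (rawE cE) (fun t => t.2.2) := (rawOfList cE).comp (snd _ _).snd'

/-- Well-formedness. [folklore] -/
theorem codeFP_wfB : CodeFP tiE bitE wfB := by
  have hnq : CodeFP tiE (pairE natE natE) (fun t => (t.1, t.2.1)) := (fst _ _).pair (snd _ _).fst'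
  have e1 : CodeFP tiE bitE (fun t => !t.2.2.isEmpty) := ((rawIsEmpty cE).comp codeFP_cs).not
  have e2 : CodeFP tiE bitE (fun t => t.2.2.all (cwfB t.1 t.2.1)) := (all codeFP_cwfB).comp (hnq.pair codeFP_cs)
  exact (e1.and e2).congr fun _ => rfl

/-- The satisfiability test of a table. [folklore] -/
theorem codeFP_satTestB : CodeFP (pairE (rawE cE) (rawE natE)) bitE (fun p => satTestB p.1 p.2) := by
  let uE : List ℕ × Constr → List Bool := pairE (rawE natE) cE
  have hm : CodeFP uE (rawE natE) (fun u => u.2.1.map fun x => u.1.getD x 0) :=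
    (map (rawGetD natE natE_zero)).comp ((fst _ _).pair ((rawOfList natE).comp (snd _ _).fst'))
  have hmem : CodeFP uE bitE (fun u => decide ((u.2.1.map fun x => u.1.getD x 0) ∈ u.2.2)) :=
    (mem (listE_injective natE_injective)).comp
      (((listOfRaw natE).comp hm).pair ((rawOfList (listE natE)).comp (snd _ _).snd'))
  exact ((all hmem).comp ((snd _ _).pair (fst _ _))).congr fun _ => rfl

/-- Brute-force satisfiability. [folklore] -/
theorem codeFP_satB (N₀ Q₀ : ℕ) : CodeFP tiE bitE (satB N₀ Q₀) :=
  ((any codeFP_satTestB).comp (codeFP_cs.pair (const tiE (tables Q₀ N₀)))).congr fun _ => rfl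

/-- The variable occurrences. [folklore] -/
theorem codeFP_varOcc : CodeFP tiE (rawE natE) (fun t => varOcc t.2.2) :=
  ((flatten natE).comp ((map₀ ((rawOfList natE).comp (fst (listE natE) (listE (listE natE))))).comp
    codeFP_cs)).congr fun _ => rfl

/-- The size guard. [folklore] -/
theorem codeFP_fitsB : CodeFP tiE bitE fitsB := by
  have hV : CodeFP tiE unE (fun t => (varOcc t.2.2).length) := (ulength natE).comp codeFP_varOcc
  exact ((natLeUn.comp ((fst _ _).pair hV)).and (natLeUn.comp ((snd _ _).fst'.pair hV))).congr fun _ => rfl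

/-- The literal width. [folklore] -/
theorem codeFP_lw : CodeFP tiE natE (fun t => lw t.2.1) := by
  have hq : CodeFP tiE natE (fun t => t.2.1) := (snd _ _).fst'
  exact ((natLt.comp (hq.pair (const tiE 1))).ite (const tiE 1) hq).congr fun _ => rfl

/-- The term of an accepting local assignment. [folklore] -/
theorem codeFP_termOf : CodeFP (pairE natE (pairE (rawE natE) (rawE natE))) (rawE natE)
    (fun p => termOf p.1 p.2.1 p.2.2) := by
  have hlit : CodeFP (pairE natE (pairE natE natE)) natE (fun p => p.2.1 * p.1 + p.2.2) :=
    natAdd.comp ((natMul.comp ((snd _ _).fst'.pair (fst _ _))).pair (snd _ _).snd')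
  exact (zipWith hlit).congr fun _ => rfl

/-- The formulas. [folklore] -/
theorem codeFP_formulasT : CodeFP tiE (listE (listE (listE natE))) (fun t => formulasT (lw t.2.1) t.2.2) := by
  -- one term, from `((q₁, vars), r)`
  let gE : (ℕ × List ℕ) × List ℕ → List Bool := pairE (pairE natE (rawE natE)) (listE natE)
  have hg : CodeFP gE (listE natE) (fun u => termOf u.1.1 u.1.2 u.2) :=
    (listOfRaw natE).comp (codeFP_termOf.comp
      ((fst _ _).fst'.pair ((fst _ _).snd'.pair ((rawOfList natE).comp (snd _ _)))))
  -- one formula, from `(q₁, C)`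
  have hφ : CodeFP (pairE natE cE) (listE (listE natE)) (fun v => v.2.2.map (termOf v.1 v.2.1)) :=
    (listOfRaw _).comp ((map hg).comp (((fst _ _).pair ((rawOfList natE).comp (snd _ _).fst')).pair
      ((rawOfList (listE natE)).comp (snd _ _).snd')))
  exact ((listOfRaw _).comp ((map hφ).comp (codeFP_lw.pair codeFP_cs))).congr fun _ => rfl

/-- The counting scan never exceeds the number of items. [folklore] -/
theorem foldl_occ_le (x : ℕ) (cs : List Constr) (k : ℕ) :
    cs.foldl (fun k C => if decide (x ∈ C.1) then k + 1 else k) k ≤ k + cs.length := by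
  rw [foldl_count_eq]
  exact Nat.add_le_add_left List.countP_le_length _

/-- The occurrence count, in unary. [folklore] -/
theorem codeFP_occF : CodeFP (pairE natE (rawE cE)) unE (fun p => occF p.2 p.1) := by
  have hstep : CodeFP (pairE natE (pairE cE unE)) unE
      (fun t => if decide (t.1 ∈ t.2.1.1) then t.2.2 + 1 else t.2.2) :=
    ((mem natE_injective).comp ((fst _ _).pair ((rawOfList natE).comp (snd _ _).fst'.fst'))).ite
      (unSucc.comp (snd _ _).snd') (snd _ _).snd'
  have h := foldl (step := fun x (C : Constr) k => if decide (x ∈ C.1) then k + 1 else k) (init := fun _ => 0)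
    hstep (const natE 0) Polynomial.X (fun x l₁ l₂ => by
      rw [length_unE, Polynomial.eval_X]
      refine (foldl_occ_le x l₁ 0).trans ?_
      rw [Nat.zero_add, pairE_apply, length_boolPair]
      have := length_le_length_rawE cE (l₁ ++ l₂)
      simp only [List.length_append] at this ⊢
      omega)
  exact h.congr fun _ => rfl

/-- The weights, raw and in unary. [folklore] -/
theorem codeFP_weightsT : CodeFP tiE (rawE unE) (fun t => weightsT t.1 (lw t.2.1) t.2.2) := by
  have hxs : CodeFP tiE (rawE natE) (fun t => List.range (min t.1 (varOcc t.2.2).length)) :=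
    (brange natE).comp (codeFP_varOcc.pair (fst _ _))
  have has : CodeFP tiE (rawE natE) (fun t => List.range (min (lw t.2.1) (0 :: varOcc t.2.2).length)) :=
    (brange natE).comp (((rawCons natE).comp ((const tiE 0).pair codeFP_varOcc)).pair codeFP_lw)
  -- inner loop: context `(cs, x)`, over `as`
  have hin : CodeFP (pairE (pairE (rawE cE) natE) natE) unE (fun u => occF u.1.1 u.1.2) :=
    codeFP_occF.comp ((fst _ _).snd'.pair (fst _ _).fst')
  -- outer loop: context `(cs, as)`, over `xs`
  have hout : CodeFP (pairE (pairE (rawE cE) (rawE natE)) natE) (rawE unE)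
      (fun u => u.1.2.map fun _ => occF u.1.1 u.2) :=
    (map hin).comp (((fst _ _).fst'.pair (snd _ _)).pair (fst _ _).snd')
  exact ((flatten unE).comp ((map hout).comp ((codeFP_cs.pair has).pair hxs))).congr fun _ => rfl

/-- **The Dinur–Safra instance on tuples is polynomial time on codes.** [cite: Hirahara2022PartialMCSP, Thm. 5.2 (proof, p. 16: the reduction is polynomial-time)] -/
theorem codeFP_outT : CodeFP tiE toE outT := by
  have hn' : CodeFP tiE natE (fun t => t.1 * lw t.2.1) := natMul.comp ((fst _ _).pair codeFP_lw)
  have hW : CodeFP tiE (listE unE) (fun t => weightsT t.1 (lw t.2.1) t.2.2) := (listOfRaw unE).comp codeFP_weightsT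
  have hs : CodeFP tiE natE (fun t => (varOcc t.2.2).length) := (natLength natE).comp codeFP_varOcc
  exact (hn'.pair (codeFP_formulasT.pair (hW.pair hs))).congr fun _ => rfl

/-- **`dinurSafraMap` on tuples is polynomial time on codes.** [cite: Hirahara2022PartialMCSP, Thm. 5.2 (proof, p. 16), with the finite patch (AroraBarak2009, §2.1)] -/
theorem codeFP_dsT (N₀ Q₀ : ℕ) : CodeFP tiE toE (dsT N₀ Q₀) := by
  have g1 : CodeFP tiE bitE (fun t => wfB t && (decide (t.1 ≤ N₀) && decide (t.2.1 ≤ Q₀))) :=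
    codeFP_wfB.and ((natLe.comp ((fst _ _).pair (const tiE N₀))).and
      (natLe.comp ((snd _ _).fst'.pair (const tiE Q₀))))
  exact (g1.ite ((codeFP_satB N₀ Q₀).ite (const tiE yesT) (const tiE noT))
    (codeFP_fitsB.ite codeFP_outT (const tiE noT))).congr fun _ => rfl

end Typed

/-! ### The instance map is polynomial time on codes -/

/-- **`dinurSafraMap N₀ Q₀` is computed on codes by a polynomial-time string function**, between the
tree's encodings of MaxCSP and CMMSA instances (typed form). [cite: Hirahara2022PartialMCSP, Thm. 5.2 (proof, p. 16: "it is NP-hard under polynomial-time many-one reductions")] -/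
theorem codeFP_dinurSafraMap (N₀ Q₀ : ℕ) :
    CodeFP CSPInstance.encoding.encode CMMSAInstance.encoding.encode (dinurSafraMap N₀ Q₀) := by
  obtain ⟨f, hf, hfd⟩ := codeFP_dsT N₀ Q₀
  refine ⟨f, hf, fun Ψ => ?_⟩
  rw [CSPInstance.encoding_encode, CMMSAInstance.encoding_encode, tiE_eq, toE_eq, hfd, dsT_toTuple]

/-- The typed statement is the implementation fact, pointwise in `N₀, Q₀` (definitional check; the
closed discharge `dinurSafraMap_mem_FP_holds` lives in `CSPToCMMSAReductionProofs.lean`). [folklore] -/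
example : dinurSafraMap_mem_FP := fun N₀ Q₀ => codeFP_dinurSafraMap N₀ Q₀

end CSPToCMMSAMachine

end Literature.Computability.Complexity
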